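import Literature.MathematicalPhysics.QuantumFieldTheory.Balaban1983to89.B4Eq220CubeField
import Literature.MathematicalPhysics.QuantumFieldTheory.Balaban1983to89.B4Lemma22Invertible
import Literature.MathematicalPhysics.QuantumFieldTheory.Balaban1983to89.B4Lemma22DualL1
import Literature.MathematicalPhysics.QuantumFieldTheory.Balaban1983to89.B4Lemma22L1Stair

/-!
# [B4] LEMMA 2.2 (2.17) AT THE CUBE CONFIGURATION `Ã_j` OF A (1.7)-REGULAR FIELD — THE REMAINING MEMBERS: the edge
# `q = ∞`, `p₁ ≤ p < ∞` for `G_k(□,Ã_j)`, `D^η_{Ã_j,μ}G_k(□,Ã_j)`, and the THIRD member `G_k(□,Ã_j)D^{η*}_{Ã_j,μ}` on the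
# whole printed parallelogram «1/p − 1/p₁ ≤ 1/q ≤ 1/p», corners included, with only «e sufficiently small»
# [Balaban1983RegularityDecay]

statement-level skeleton of published theorems with citation tags; proofs where landed; nothing here is a claim about the Yang–Mills mass gap

CITATION HEADER.  T. Bałaban, *Regularity and decay of lattice Green's functions*, Commun. Math. Phys. **89** (1983)
571–597, doi:10.1007/bf01214744 [Balaban1983RegularityDecay] (cell paper B4; held text
`paper:balaban1983-cmp89-regularity-decay`, journal page = PDF page + 570; pp. 573, 575, 577–578, 581, 583).  PDF held:
yes.  Unit `lit-balaban-p35` gen 7 (Phase-2 proof seat), HOME `run/shared/lean/pub/lit-balaban/`.  WHAT IS REPRODUCED: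
SKELETON row **B4.Lem2.2** (Lemma 2.2 (2.17), all three members, at the cube configurations `Ã_j` of p. 575 of a field
assumed only (1.7)-regular) — the members NOT covered by gen 6's `B4Eq220CubeField.lemma22_sup_cubeField` (corner
`q = p = ∞`, members `G`, `D_ÃG`) / `lemma22_weighted_cubeField` (`1 ≤ p ≤ q < ∞`, members `G`, `D_ÃG`).  Companion of
the typed leaf `B4Lemma22RegularCubeFam` (b04's `B4.Lemma22Printed` on the regular cube-field family).  Imports gen 6's
`B4Eq220CubeField` (closure: `B4CubeFieldHyps22`, `B4CubeFields22`, `B4Lemma22EtaBox`), gen 4's `B4Lemma22Invertible`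
and the b2b lineage's `B4Lemma22DualL1` / `B4Lemma22L1Stair` (the two corners of the third member).

WHAT IS PRINTED (pp. 577–578, verbatim).  «Lemma 2.2. Let a rectangular parallelepiped □ be a sum of few large blocks
(e.g., as in the case of the cubes □_j), and let Ã be a regular vector field configuration in the sense of Proposition
I.2.1, constant in a neighbourhood of the boundary of □. Then for e sufficiently small and α < 1, there exists a
constant c₁ … (2.16) and a constant c₂ depending on d, p₁, such that ‖G_k(□,Ã)f‖_q, ‖D^η_{Ã,μ}G_k(□,Ã)f‖_q,
‖G_k(□,Ã)D^{η*}_{Ã,μ}f‖_q ≤ c₂‖f‖_p (2.17) for 1 ≤ p, q ≤ ∞, satisfying the condition 1/p − 1/p₁ ≤ 1/q ≤ 1/p with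
p₁ > d.»; p. 583: «For q = p = 1 we get it by duality argument, i.e. using the fact that the space L^∞(□) is adjoint
to L¹(□). … the operators G_k(□), ∂^η_μG_k(□), G_k(□)∂^{η*}_μ are bounded operators from L^{p₁}(□) with p₁ > d to
L^∞(□) … Again by the duality argument … The Riesz-Thorin Theorem gives us finally (2.17) for G_k(□) and for all p, q
described in the figure»; p. 575: «if □_j is an interior cube of Ω, then … Ã_j = A₀ + θ_jA′»; p. 573 (1.7):
«|(∂^η_μA)(x)| ≤ ce^{β−1}», «for e sufficiently small».

WHAT THIS MODULE PROVES (all in full; `d + 1` lattice dimensions, so the print's «p₁ > d» is `p₁ > d + 1`; box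
`□ = Π_μ[0, nM_μ)`, `n = L^k`, `L = ℓ + 1 ≥ 2`, `M_μ ≤ S`, the cube of the label `j` inside (`K(j_μ + 1) ≤ M_μ`,
`j_μ ≥ 1`), `nK ≥ 16`; `A` in component form, (1.7)-regular on `□` with constants `c, β > 0`; coupling `e/n`; staircase
block contours; the `η`-weighted norms `‖·‖_{p,η} = lpW` of `B4Lemma22EtaBox`, `‖·‖_∞ = supN`).  QUANTIFIER ORDER (the
print's): the constant `C` first (Lemma 2.2 at charge `1`: `d`, `N`, flow, `L`, the windows `[a₋,a₊]`, `[0,m²₊]`,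
`p₁`), then for `(c, β, S, K)` a threshold `e₁`, then the instance (mesh, `a`, `m²`, box, label, field, `0 < e ≤ e₁`).
* **`lemma22_psup_cubeField`** — the edge `q = ∞`, `p₁ ≤ p < ∞`, members `G`, `D_ÃG`: `‖G_k(□,Ã_j)Φ‖_∞ ≤ C‖Φ‖_{p,η}`,
  `‖D^η_{Ã_j,μ}G_k(□,Ã_j)Φ‖_∞ ≤ C‖Φ‖_{p,η}` («bounded operators from L^{p₁}(□) … to L^∞(□)»; the lineage's
  `B4Lemma22EtaBox.lemma22_17_weighted_box_sup` with invertibility, contour sums, field hypotheses and smallness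
  DISCHARGED).
* **`lemma22_dual_cubeField`** — the third member on `1 < p ≤ q < ∞`, `1/p − 1/q ≤ 1/p₁`:
  `‖G_k(□,Ã_j)(D^η_{Ã_j,μ})ᵀΦ‖_{q,η} ≤ C‖Φ‖_{p,η}` (`…_box_dual` discharged; «Again by the duality argument»).
* **`lemma22_dual_one_cubeField`** — the third member on the edge `p = 1 < q`, `1 − 1/q ≤ 1/p₁`:
  `‖G_k(□,Ã_j)(D^η_{Ã_j,μ})ᵀΦ‖_{q,η} ≤ C‖Φ‖_{1,η}` (`…_box_dual_one` discharged).
* **`lemma22_dual_sup_cubeField`** — the third member on the edge `q = ∞`, `p₁ ≤ p < ∞`: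
  `‖G_k(□,Ã_j)(D^η_{Ã_j,μ})ᵀΦ‖_∞ ≤ C‖Φ‖_{p,η}` (`…_box_dual_sup` discharged).
* **`lemma22_dual_corners_cubeField`** — the third member at the two corners: `‖G(D_Ã)ᵀΦ‖_{1,η} ≤ C‖Φ‖_{1,η}` («For
  q = p = 1 we get it by duality argument»: `B4Lemma22DualL1.lemma22_17_l1_stair` discharged; `‖·‖_{1,η} = η^{d+1}‖·‖₁`,
  `lpW_one_eq`) and `‖G(D_Ã)ᵀΦ‖_∞ ≤ C‖Φ‖_∞` (`B4Lemma22L1Stair.lemma22_17_l1_deriv_stair` discharged).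
Here `(D^η_{Ã,μ})ᵀ` is the real adjoint `D^{η*}_{Ã,μ}` of the lineage's covariant derivative `derivA` (the transpose
for the unweighted pairing on `□ × colours`; the `η^{d+1}`-weighted pairing has the same adjoint).  Mechanism, as in
gen 6: the lineage's theorems at charge `1` applied to the field `(e/n)Ã_j = (e/n)A₀ + A′`
(`B4CubeFieldHyps22.greenA_smul/derivA_smul/smul_cubeField`), their field hypotheses supplied by `cubeField_hyps`,
the invertibility by `B4Lemma22Invertible.opA_stair_isUnit_det` (every field), the contour sums `τ = (d+1)θ` by
`B4Lemma22SupStair.stair_lsum_le`, the smallness conditions by `cubeField_threshold`.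

HONEST SCOPE.  (i) Interior cubes, box carriers of the Lemma-2.2 lineage with staircase contours, as in gen 6; `A₀`
sampled at the box corner, so `e₁` depends on `(c, β, S, K)` besides the Lemma-2.2 data («c′ = dMc»).  (ii) `C`
depends on `(d, N, flow Lipschitz constant, L, a₋, a₊, m²₊, p₁)` (the print: «depending on d, p₁»), as in every node
of this lineage; the interpolation inside `B4Lemma22EtaBox` is the positive-kernel Riesz convexity theorem of
`B4Lemma22InterpBox`, recorded there.  (iii) With gen 6's two theorems this file exhausts the printed parallelogram
for all three members at `Ã_j` (every pair `1 ≤ p ≤ q ≤ ∞` with `1/p − 1/q ≤ 1/p₁` has `p < ∞` or `p = q = ∞`).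
Theorems only; no `def`, no `Prop` fact, no `sorry`; axioms standard.
-/

namespace Literature.MathematicalPhysics.QuantumFieldTheory.Balaban1983to89.B4Lemma22EdgesCubeField

open Finset Matrix
open Literature.MathematicalPhysics.QuantumFieldTheory.Balaban1983to89.B4GaugeCovariance
open Literature.MathematicalPhysics.QuantumFieldTheory.Balaban1983to89.B4Reflection242 (boxDom nbrs)
open Literature.MathematicalPhysics.QuantumFieldTheory.Balaban1983to89.B4Lower18Regular (e1 baseEmb stairContour
  stairContour_end lsum)
open Literature.MathematicalPhysics.QuantumFieldTheory.Balaban1983to89.B4Lemma22Reduce231 (supN supN_nonneg l1N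
  l1N_nonneg)
open Literature.MathematicalPhysics.QuantumFieldTheory.Balaban1983to89.B4Lemma22ReduceZero (Box opA greenA derivA)
open Literature.MathematicalPhysics.QuantumFieldTheory.Balaban1983to89.B4Lemma22LpStair (lpM lpM_one)
open Literature.MathematicalPhysics.QuantumFieldTheory.Balaban1983to89.B4Lemma22EtaBox (vol vol_pos lpW lpW_nonneg
  lemma22_17_weighted_box_sup lemma22_17_weighted_box_dual lemma22_17_weighted_box_dual_one
  lemma22_17_weighted_box_dual_sup)
open Literature.MathematicalPhysics.QuantumFieldTheory.Balaban1983to89.B4Lemma22SupStair (stair_lsum_le)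
open Literature.MathematicalPhysics.QuantumFieldTheory.Balaban1983to89.B4Lemma22Invertible (opA_stair_isUnit_det)
open Literature.MathematicalPhysics.QuantumFieldTheory.Balaban1983to89.B4Lemma22DualL1 (lemma22_17_l1_stair)
open Literature.MathematicalPhysics.QuantumFieldTheory.Balaban1983to89.B4Lemma22L1Stair (lemma22_17_l1_deriv_stair)
open Literature.MathematicalPhysics.QuantumFieldTheory.Balaban1983to89.B4PartitionUnity22 (thetaProf D1 D1_nonneg
  contDiff_thetaProf hasCompactSupport_thetaProf)
open Literature.MathematicalPhysics.QuantumFieldTheory.Balaban1983to89.B4CubeFields22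
open Literature.MathematicalPhysics.QuantumFieldTheory.Balaban1983to89.B4CubeFieldHyps22

noncomputable section

variable {d : ℕ}

/-! ## §1. The package of discharged hypotheses at `Ã_j` (general contour data of the lineage: `emb`, `Γ`, `τ`) -/

section Package

variable {ι : Type} [Fintype ι] [DecidableEq ι]

/-- **THE HYPOTHESES OF THE LEMMA-2.2 LINEAGE (GENERAL-CONTOUR FORM) AT `Ã_j`, ALL DISCHARGED**: for the box
`□ = Π_μ[0, nM_μ)` with the staircase block contours, the cube of `j` inside, `A` (1.7)-regular with `(c, β)`,
`0 < e`, and the scaled parts `A₀′ = (e/n)A(0)`, `A′ = (e/n)θ_jA′`: invertibility of `H_k(□, A₀′ + A′)` at charge `1`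
(gen 4), the bond size `θ = (d+1)S·c·e^β`, the derivative size `θ′ = c·e^β(1 + D1(θ)(d+1)S/K)`, vanishing at the faces
(gen 6), and the staircase contour sums `τ = (d+1)θ` (`stair_lsum_le`) — exactly the binders
`hunit/hθ/hA′/hθ′/hder/hbd/hτ0/hτ` of `B4Lemma22EtaBox.lemma22_17_weighted_box_sup/…_dual/…_dual_one/…_dual_sup`.
[cite: Balaban1983RegularityDecay, §2 p. 575 «A′ is regular and small … c′ = dMc», (1.7) p. 573] -/
theorem cubeField_pkg (F : OrthFlow ι) {ℓ k : ℕ} (hℓ : 1 ≤ ℓ) (hk : 1 ≤ k) (hn : 1 ≤ (ℓ + 1) ^ k)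
    {a m2 : ℝ} (ha : 0 < a) (hm : 0 ≤ m2) {M : Fin (d + 1) → ℕ} {S K : ℕ}
    (hS : ∀ i, M i ≤ S) (hK : 1 ≤ K) (hnK : 16 ≤ (ℓ + 1) ^ k * K) {j : Fin (d + 1) → ℤ} (hjlo : ∀ μ, 1 ≤ j μ)
    (hjhi : ∀ μ, (K : ℤ) * (j μ + 1) ≤ M μ) {Ac : (Fin (d + 1) → ℤ) → Fin (d + 1) → ℝ} {creg β e : ℝ}
    (hcreg : 0 ≤ creg) (he : 0 < e)
    (h17 : ∀ x ∈ Box d ℓ k M, ∀ μ ν : Fin (d + 1),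
      |Ac (x + e1 μ) ν - Ac x ν| ≤ creg * e ^ (β - 1) / ((ℓ + 1) ^ k : ℕ)) :
    let A' : ↥(Box d ℓ k M) → ↥(Box d ℓ k M) → ℝ :=
      fun u v => e / ((ℓ + 1) ^ k : ℕ) * cubeFluct (Box d ℓ k M) ((ℓ + 1) ^ k) K j (Ac 0) Ac u v
    let A₀' : Fin (d + 1) → ℝ := fun ν => e / ((ℓ + 1) ^ k : ℕ) * Ac 0 ν
    let θ : ℝ := ((d : ℝ) + 1) * S * creg * e ^ β
    let θ' : ℝ := creg * e ^ β * (1 + D1 thetaProf * (((d : ℝ) + 1) * S) / K)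
    IsUnit (opA d F 1 ℓ k a m2 M (baseEmb hn M) (stairContour hn M) (constBond A₀' Subtype.val + A')).det ∧
    0 ≤ θ ∧ (∀ x y : ↥(Box d ℓ k M), y.1 ∈ nbrs x.1 → |1 * A' x y| ≤ θ / ((ℓ + 1) ^ k : ℕ)) ∧
    0 ≤ θ' ∧ (∀ (x z y : ↥(Box d ℓ k M)) (μ : Fin (d + 1)), z.1 = x.1 + e1 μ → y.1 = z.1 + e1 μ →
      |1 * (A' y z - A' z x)| ≤ θ' / (((ℓ + 1) ^ k : ℕ) : ℝ) ^ 2 ∧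
      |1 * (A' x z - A' z y)| ≤ θ' / (((ℓ + 1) ^ k : ℕ) : ℝ) ^ 2) ∧
    (∀ (x y : ↥(Box d ℓ k M)) (μ : Fin (d + 1)), y.1 = x.1 + e1 μ →
      (x.1 - e1 μ ∉ Box d ℓ k M ∨ y.1 + e1 μ ∉ Box d ℓ k M) → A' x y = 0 ∧ A' y x = 0) ∧
    0 ≤ ((d : ℝ) + 1) * θ ∧
    (∀ y x, blkWt ((ℓ + 1) ^ k) M (fun i => (ℓ + 1) ^ k * M i) y x ≠ 0 →
      |1 * lsum A' (baseEmb hn M y) (stairContour hn M y x)| ≤ ((d : ℝ) + 1) * θ) := by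
  intro A' A₀' θ θ'
  obtain ⟨-, hA', hder, hbd⟩ := cubeField_hyps (d := d) hn hS hK hnK hjlo hjhi hcreg he h17 (β := β)
  have heβ : 0 ≤ e ^ β := (Real.rpow_pos_of_pos he β).le
  have hD : 0 ≤ D1 thetaProf := D1_nonneg contDiff_thetaProf hasCompactSupport_thetaProf
  have hθ0 : 0 ≤ θ := by positivity
  have hθ'0 : 0 ≤ θ' := by positivity
  refine ⟨opA_stair_isUnit_det F 1 hℓ hk hn ha hm M _, hθ0, hA', hθ'0, hder, hbd, by positivity, ?_⟩
  intro y x _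
  exact stair_lsum_le 1 hn M hθ0 hA' y x

end Package

/-! ## §2. The edge `q = ∞`, `p₁ ≤ p < ∞`, members `G`, `D_ÃG` -/

section SupEdge

variable {ι : Type} [Fintype ι] [DecidableEq ι]

/-- **LEMMA 2.2 (2.17), THE EDGE `q = ∞`, `p₁ ≤ p < ∞`, MEMBERS `G_k(□,Ã_j)`, `D^η_{Ã_j,μ}G_k(□,Ã_j)`, AT THE CUBE
CONFIGURATION OF A (1.7)-REGULAR FIELD, WITH ONLY «e SUFFICIENTLY SMALL»** («the operators G_k(□), ∂^η_μG_k(□) … are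
bounded operators from L^{p₁}(□) with p₁ > d to L^∞(□)», here at `Ã_j`; `p₁ > d + 1` = the lattice dimension): there
is `C > 0` (Lemma 2.2 at charge `1`) such that for every `(c, β)`, `β > 0`, side bound `S` and cube size `K ≥ 1` there
is `e₁ > 0` with: for every mesh `n = L^k` (`nK ≥ 16`), `a, m²` of the windows, box `□ = Π_μ[0, nM_μ)` (`M_μ ≤ S`),
label `j` with its cube inside, every (1.7)-regular `A` on `□`, `0 < e ≤ e₁`, every `p ≥ p₁` and `Φ`:
`‖G_k(□,Ã_j)Φ‖_∞ ≤ C‖Φ‖_{p,η}` and `‖D^η_{Ã_j,μ}G_k(□,Ã_j)Φ‖_∞ ≤ C‖Φ‖_{p,η}` for every `μ` (coupling `e/n`, staircase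
contours; `B4Lemma22EtaBox.lemma22_17_weighted_box_sup` with every operator-side and field hypothesis DISCHARGED).
[cite: Balaban1983RegularityDecay, Lemma 2.2 (2.17) p. 578 with (2.40)–(2.41) p. 583, §2 p. 575 (Ã_j), (1.7) p. 573] -/
theorem lemma22_psup_cubeField (F : OrthFlow ι) {ℓ₁ : ℝ} (hℓ₁ : 0 ≤ ℓ₁)
    (hLip : ∀ t (v : ι → ℝ), ((F.U t - 1) *ᵥ v) ⬝ᵥ ((F.U t - 1) *ᵥ v) ≤ (ℓ₁ * t) ^ 2 * (v ⬝ᵥ v))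
    (d ℓ : ℕ) (hℓ : 1 ≤ ℓ) (amin aplus m2plus : ℝ) (ha : 0 < amin) {p₁ : ℝ} (hp₁ : (d : ℝ) + 1 < p₁) :
    ∃ C : ℝ, 0 < C ∧ ∀ (creg β : ℝ), 0 ≤ creg → 0 < β → ∀ (S K : ℕ), 1 ≤ K →
      ∃ e₁ : ℝ, 0 < e₁ ∧ ∀ (k : ℕ), 1 ≤ k → ∀ (hn : 1 ≤ (ℓ + 1) ^ k), 16 ≤ (ℓ + 1) ^ k * K →
      ∀ (a m2 : ℝ), amin ≤ a → a ≤ aplus → 0 ≤ m2 → m2 ≤ m2plus →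
      ∀ (M : Fin (d + 1) → ℕ), (∀ i, 1 ≤ M i) → (∀ i, M i ≤ S) →
      ∀ (j : Fin (d + 1) → ℤ), (∀ μ, 1 ≤ j μ) → (∀ μ, (K : ℤ) * (j μ + 1) ≤ M μ) →
      ∀ (Ac : (Fin (d + 1) → ℤ) → Fin (d + 1) → ℝ) (e : ℝ), 0 < e → e ≤ e₁ →
        (∀ x ∈ Box d ℓ k M, ∀ μ ν : Fin (d + 1),
          |Ac (x + e1 μ) ν - Ac x ν| ≤ creg * e ^ (β - 1) / ((ℓ + 1) ^ k : ℕ)) →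
      ∀ (p : ℝ), p₁ ≤ p →
      ∀ Φ : ↥(Box d ℓ k M) × ι → ℝ,
        supN (greenA d F (e / ((ℓ + 1) ^ k : ℕ)) ℓ k a m2 M (baseEmb hn M) (stairContour hn M)
            (cubeField (Box d ℓ k M) ((ℓ + 1) ^ k) K j (Ac 0) Ac) *ᵥ Φ) ≤ C * lpW d ℓ k p Φ ∧
        ∀ μ : Fin (d + 1),
          supN (derivA d F (e / ((ℓ + 1) ^ k : ℕ)) ℓ k M (cubeField (Box d ℓ k M) ((ℓ + 1) ^ k) K j (Ac 0) Ac) μ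
              *ᵥ (greenA d F (e / ((ℓ + 1) ^ k : ℕ)) ℓ k a m2 M (baseEmb hn M) (stairContour hn M)
                  (cubeField (Box d ℓ k M) ((ℓ + 1) ^ k) K j (Ac 0) Ac) *ᵥ Φ))
            ≤ C * lpW d ℓ k p Φ := by
  obtain ⟨c, hc, C', hC', hL⟩ := lemma22_17_weighted_box_sup F hℓ₁ hLip 1 d ℓ hℓ amin aplus m2plus ha hp₁
  set C : ℝ := (2 + ℓ₁) * (2 * C') with hC_def
  have hC0 : 0 < C := by rw [hC_def]; positivity
  refine ⟨C, hC0, fun creg β hcreg hβ S K hK1 => ?_⟩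
  obtain ⟨e₁, he₁, hth⟩ := cubeField_threshold d (c := c) (aplus := aplus) hℓ₁ hc.le ha hcreg hβ S K
  refine ⟨e₁, he₁, ?_⟩
  intro k hk hn hnK a m2 e1' e2 e3 e4 M hM hS j hjlo hjhi Ac e he hle h17 p hp Φ
  obtain ⟨hak1, hak2⟩ := aSeq_window hℓ hk ha e1' e2
  obtain ⟨hθ1, -, hsm⟩ := hth e he hle _ hak1 hak2
  have ha' : 0 < a := lt_of_lt_of_le ha e1'
  obtain ⟨hunit, hθ0, hA', hθ'0, hder, hbd, hτ0, hτ⟩ :=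
    cubeField_pkg F hℓ hk hn ha' e3 hS hK1 hnK hjlo hjhi hcreg he h17 (β := β)
  obtain ⟨main0, -, main2⟩ := hL k hk a m2 e1' e2 e3 e4 M hM (baseEmb hn M) (stairContour hn M)
    (fun y x hw => stairContour_end hn M y x hw) (fun μ => e / ((ℓ + 1) ^ k : ℕ) * Ac 0 μ) _ _ _ _
    hunit hθ0 hA' hθ'0 hder hbd hτ0 hτ hsm p hp Φ
  have hc2 : 0 ≤ 2 * C' := by positivity
  have hC1 : 2 * C' ≤ C := by rw [hC_def]; nlinarith
  have hC2 : (1 + ℓ₁ * (((d : ℝ) + 1) * S * creg * e ^ β)) * (2 * C') ≤ C := by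
    rw [hC_def]
    refine mul_le_mul_of_nonneg_right ?_ hc2
    have : ℓ₁ * (((d : ℝ) + 1) * S * creg * e ^ β) ≤ ℓ₁ * 1 := mul_le_mul_of_nonneg_left hθ1 hℓ₁
    linarith
  constructor
  · rw [greenA_smul, smul_cubeField]
    exact main0.trans (mul_le_mul_of_nonneg_right hC1 (lpW_nonneg d ℓ k p Φ))
  · intro μ
    rw [derivA_smul, greenA_smul, smul_cubeField]
    exact (main2 μ).trans (mul_le_mul_of_nonneg_right hC2 (lpW_nonneg d ℓ k p Φ))

end SupEdge

/-! ## §3. The third member `G_k(□,Ã_j)(D^η_{Ã_j,μ})ᵀ = G_k(□,Ã_j)D^{η*}_{Ã_j,μ}` on the parallelogram -/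

section Dual

variable {ι : Type} [Fintype ι] [DecidableEq ι]

/-- the conjugate exponent of `q > 1` is `≥ p₁` when `1 − 1/q ≤ 1/p₁` (`p₁ > 0`).
[cite: Balaban1983RegularityDecay, Lemma 2.2 (2.17) p. 578 «1/p − 1/p₁ ≤ 1/q», dictionary] -/
theorem p1_le_conjExponent {q p₁ : ℝ} (hq : 1 < q) (hp₁ : 0 < p₁) (h : 1 - q⁻¹ ≤ p₁⁻¹) :
    p₁ ≤ q.conjExponent := by
  have hqc : q.HolderConjugate q.conjExponent := Real.HolderConjugate.conjExponent hq
  have hq'pos : 0 < q.conjExponent := hqc.symm.pos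
  have hinv : q.conjExponent⁻¹ = 1 - q⁻¹ := by
    have := hqc.inv_add_inv_eq_one
    linarith
  have h2 : q.conjExponent⁻¹ ≤ p₁⁻¹ := by rw [hinv]; exact h
  exact (inv_le_inv₀ hq'pos hp₁).1 h2

/-- **LEMMA 2.2 (2.17), THIRD MEMBER `G_k(□,Ã_j)D^{η*}_{Ã_j,μ}`, ALL PAIRS `1 < p ≤ q < ∞` WITH `1/p − 1/q ≤ 1/p₁`, AT
THE CUBE CONFIGURATION OF A (1.7)-REGULAR FIELD, WITH ONLY «e SUFFICIENTLY SMALL»** (same quantifier discipline as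
`lemma22_psup_cubeField`): `‖G_k(□,Ã_j)(D^η_{Ã_j,μ})ᵀΦ‖_{q,η} ≤ C‖Φ‖_{p,η}` for every `μ` («Again by the duality
argument»; `B4Lemma22EtaBox.lemma22_17_weighted_box_dual` with every operator-side and field hypothesis DISCHARGED, the
conjugate exponents supplied by `Real.conjExponent`).
[cite: Balaban1983RegularityDecay, Lemma 2.2 (2.17) p. 578 with p. 583, §2 p. 575 (Ã_j), (1.7) p. 573] -/
theorem lemma22_dual_cubeField (F : OrthFlow ι) {ℓ₁ : ℝ} (hℓ₁ : 0 ≤ ℓ₁)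
    (hLip : ∀ t (v : ι → ℝ), ((F.U t - 1) *ᵥ v) ⬝ᵥ ((F.U t - 1) *ᵥ v) ≤ (ℓ₁ * t) ^ 2 * (v ⬝ᵥ v))
    (d ℓ : ℕ) (hℓ : 1 ≤ ℓ) (amin aplus m2plus : ℝ) (ha : 0 < amin) {p₁ : ℝ} (hp₁ : (d : ℝ) + 1 < p₁) :
    ∃ C : ℝ, 0 < C ∧ ∀ (creg β : ℝ), 0 ≤ creg → 0 < β → ∀ (S K : ℕ), 1 ≤ K →
      ∃ e₁ : ℝ, 0 < e₁ ∧ ∀ (k : ℕ), 1 ≤ k → ∀ (hn : 1 ≤ (ℓ + 1) ^ k), 16 ≤ (ℓ + 1) ^ k * K →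
      ∀ (a m2 : ℝ), amin ≤ a → a ≤ aplus → 0 ≤ m2 → m2 ≤ m2plus →
      ∀ (M : Fin (d + 1) → ℕ), (∀ i, 1 ≤ M i) → (∀ i, M i ≤ S) →
      ∀ (j : Fin (d + 1) → ℤ), (∀ μ, 1 ≤ j μ) → (∀ μ, (K : ℤ) * (j μ + 1) ≤ M μ) →
      ∀ (Ac : (Fin (d + 1) → ℤ) → Fin (d + 1) → ℝ) (e : ℝ), 0 < e → e ≤ e₁ →
        (∀ x ∈ Box d ℓ k M, ∀ μ ν : Fin (d + 1),
          |Ac (x + e1 μ) ν - Ac x ν| ≤ creg * e ^ (β - 1) / ((ℓ + 1) ^ k : ℕ)) →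
      ∀ (p q : ℝ), 1 < p → p ≤ q → p⁻¹ - q⁻¹ ≤ p₁⁻¹ →
      ∀ (Φ : ↥(Box d ℓ k M) × ι → ℝ) (μ : Fin (d + 1)),
        lpW d ℓ k q ((greenA d F (e / ((ℓ + 1) ^ k : ℕ)) ℓ k a m2 M (baseEmb hn M) (stairContour hn M)
              (cubeField (Box d ℓ k M) ((ℓ + 1) ^ k) K j (Ac 0) Ac)
            * (derivA d F (e / ((ℓ + 1) ^ k : ℕ)) ℓ k M (cubeField (Box d ℓ k M) ((ℓ + 1) ^ k) K j (Ac 0) Ac) μ)ᵀ)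
            *ᵥ Φ) ≤ C * lpW d ℓ k p Φ := by
  obtain ⟨c, hc, C', hC', hL⟩ := lemma22_17_weighted_box_dual F hℓ₁ hLip 1 d ℓ hℓ amin aplus m2plus ha hp₁
  set C : ℝ := (2 + ℓ₁) * (2 * C') with hC_def
  have hC0 : 0 < C := by rw [hC_def]; positivity
  refine ⟨C, hC0, fun creg β hcreg hβ S K hK1 => ?_⟩
  obtain ⟨e₁, he₁, hth⟩ := cubeField_threshold d (c := c) (aplus := aplus) hℓ₁ hc.le ha hcreg hβ S K
  refine ⟨e₁, he₁, ?_⟩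
  intro k hk hn hnK a m2 e1' e2 e3 e4 M hM hS j hjlo hjhi Ac e he hle h17 p q hp hpq hσ Φ μ
  obtain ⟨hak1, hak2⟩ := aSeq_window hℓ hk ha e1' e2
  obtain ⟨hθ1, -, hsm⟩ := hth e he hle _ hak1 hak2
  have ha' : 0 < a := lt_of_lt_of_le ha e1'
  obtain ⟨hunit, hθ0, hA', hθ'0, hder, hbd, hτ0, hτ⟩ :=
    cubeField_pkg F hℓ hk hn ha' e3 hS hK1 hnK hjlo hjhi hcreg he h17 (β := β)
  have hq1 : 1 < q := lt_of_lt_of_le hp hpq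
  obtain ⟨-, main2⟩ := hL k hk a m2 e1' e2 e3 e4 M hM (baseEmb hn M) (stairContour hn M)
    (fun y x hw => stairContour_end hn M y x hw) (fun μ => e / ((ℓ + 1) ^ k : ℕ) * Ac 0 μ) _ _ _ _
    hunit hθ0 hA' hθ'0 hder hbd hτ0 hτ hsm p p.conjExponent q q.conjExponent
    (Real.HolderConjugate.conjExponent hp) (Real.HolderConjugate.conjExponent hq1) hpq hσ Φ
  have hc2 : 0 ≤ 2 * C' := by positivity
  have hC2 : (1 + ℓ₁ * (((d : ℝ) + 1) * S * creg * e ^ β)) * (2 * C') ≤ C := by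
    rw [hC_def]
    refine mul_le_mul_of_nonneg_right ?_ hc2
    have : ℓ₁ * (((d : ℝ) + 1) * S * creg * e ^ β) ≤ ℓ₁ * 1 := mul_le_mul_of_nonneg_left hθ1 hℓ₁
    linarith
  rw [derivA_smul, greenA_smul, smul_cubeField]
  exact (main2 μ).trans (mul_le_mul_of_nonneg_right hC2 (lpW_nonneg d ℓ k p Φ))

/-- **LEMMA 2.2 (2.17), THIRD MEMBER, THE EDGE `p = 1 < q` WITH `1 − 1/q ≤ 1/p₁` (I.E. `q ≤ p₁′`), AT THE CUBE
CONFIGURATION OF A (1.7)-REGULAR FIELD, WITH ONLY «e SUFFICIENTLY SMALL»**: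
`‖G_k(□,Ã_j)(D^η_{Ã_j,μ})ᵀΦ‖_{q,η} ≤ C‖Φ‖_{1,η}` for every `μ` («using the fact that the space L^∞(□) is adjoint to
L¹(□)»; `B4Lemma22EtaBox.lemma22_17_weighted_box_dual_one` with every operator-side and field hypothesis DISCHARGED).
[cite: Balaban1983RegularityDecay, Lemma 2.2 (2.17) p. 578 with p. 583, §2 p. 575 (Ã_j), (1.7) p. 573] -/
theorem lemma22_dual_one_cubeField (F : OrthFlow ι) {ℓ₁ : ℝ} (hℓ₁ : 0 ≤ ℓ₁)
    (hLip : ∀ t (v : ι → ℝ), ((F.U t - 1) *ᵥ v) ⬝ᵥ ((F.U t - 1) *ᵥ v) ≤ (ℓ₁ * t) ^ 2 * (v ⬝ᵥ v))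
    (d ℓ : ℕ) (hℓ : 1 ≤ ℓ) (amin aplus m2plus : ℝ) (ha : 0 < amin) {p₁ : ℝ} (hp₁ : (d : ℝ) + 1 < p₁) :
    ∃ C : ℝ, 0 < C ∧ ∀ (creg β : ℝ), 0 ≤ creg → 0 < β → ∀ (S K : ℕ), 1 ≤ K →
      ∃ e₁ : ℝ, 0 < e₁ ∧ ∀ (k : ℕ), 1 ≤ k → ∀ (hn : 1 ≤ (ℓ + 1) ^ k), 16 ≤ (ℓ + 1) ^ k * K →
      ∀ (a m2 : ℝ), amin ≤ a → a ≤ aplus → 0 ≤ m2 → m2 ≤ m2plus →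
      ∀ (M : Fin (d + 1) → ℕ), (∀ i, 1 ≤ M i) → (∀ i, M i ≤ S) →
      ∀ (j : Fin (d + 1) → ℤ), (∀ μ, 1 ≤ j μ) → (∀ μ, (K : ℤ) * (j μ + 1) ≤ M μ) →
      ∀ (Ac : (Fin (d + 1) → ℤ) → Fin (d + 1) → ℝ) (e : ℝ), 0 < e → e ≤ e₁ →
        (∀ x ∈ Box d ℓ k M, ∀ μ ν : Fin (d + 1),
          |Ac (x + e1 μ) ν - Ac x ν| ≤ creg * e ^ (β - 1) / ((ℓ + 1) ^ k : ℕ)) →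
      ∀ (q : ℝ), 1 < q → 1 - q⁻¹ ≤ p₁⁻¹ →
      ∀ (Φ : ↥(Box d ℓ k M) × ι → ℝ) (μ : Fin (d + 1)),
        lpW d ℓ k q ((greenA d F (e / ((ℓ + 1) ^ k : ℕ)) ℓ k a m2 M (baseEmb hn M) (stairContour hn M)
              (cubeField (Box d ℓ k M) ((ℓ + 1) ^ k) K j (Ac 0) Ac)
            * (derivA d F (e / ((ℓ + 1) ^ k : ℕ)) ℓ k M (cubeField (Box d ℓ k M) ((ℓ + 1) ^ k) K j (Ac 0) Ac) μ)ᵀ)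
            *ᵥ Φ) ≤ C * lpW d ℓ k 1 Φ := by
  obtain ⟨c, hc, C', hC', hL⟩ := lemma22_17_weighted_box_dual_one F hℓ₁ hLip 1 d ℓ hℓ amin aplus m2plus ha hp₁
  have hp₁0 : 0 < p₁ := lt_trans (by positivity) hp₁
  set C : ℝ := (2 + ℓ₁) * (2 * C') with hC_def
  have hC0 : 0 < C := by rw [hC_def]; positivity
  refine ⟨C, hC0, fun creg β hcreg hβ S K hK1 => ?_⟩
  obtain ⟨e₁, he₁, hth⟩ := cubeField_threshold d (c := c) (aplus := aplus) hℓ₁ hc.le ha hcreg hβ S K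
  refine ⟨e₁, he₁, ?_⟩
  intro k hk hn hnK a m2 e1' e2 e3 e4 M hM hS j hjlo hjhi Ac e he hle h17 q hq hσ Φ μ
  obtain ⟨hak1, hak2⟩ := aSeq_window hℓ hk ha e1' e2
  obtain ⟨hθ1, -, hsm⟩ := hth e he hle _ hak1 hak2
  have ha' : 0 < a := lt_of_lt_of_le ha e1'
  obtain ⟨hunit, hθ0, hA', hθ'0, hder, hbd, hτ0, hτ⟩ :=
    cubeField_pkg F hℓ hk hn ha' e3 hS hK1 hnK hjlo hjhi hcreg he h17 (β := β)
  obtain ⟨-, main2⟩ := hL k hk a m2 e1' e2 e3 e4 M hM (baseEmb hn M) (stairContour hn M)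
    (fun y x hw => stairContour_end hn M y x hw) (fun μ => e / ((ℓ + 1) ^ k : ℕ) * Ac 0 μ) _ _ _ _
    hunit hθ0 hA' hθ'0 hder hbd hτ0 hτ hsm q q.conjExponent (Real.HolderConjugate.conjExponent hq)
    (p1_le_conjExponent hq hp₁0 hσ) Φ
  have hc2 : 0 ≤ 2 * C' := by positivity
  have hC2 : (1 + ℓ₁ * (((d : ℝ) + 1) * S * creg * e ^ β)) * (2 * C') ≤ C := by
    rw [hC_def]
    refine mul_le_mul_of_nonneg_right ?_ hc2
    have : ℓ₁ * (((d : ℝ) + 1) * S * creg * e ^ β) ≤ ℓ₁ * 1 := mul_le_mul_of_nonneg_left hθ1 hℓ₁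
    linarith
  rw [derivA_smul, greenA_smul, smul_cubeField]
  exact (main2 μ).trans (mul_le_mul_of_nonneg_right hC2 (lpW_nonneg d ℓ k 1 Φ))

/-- **LEMMA 2.2 (2.17), THIRD MEMBER, THE EDGE `q = ∞`, `p₁ ≤ p < ∞`, AT THE CUBE CONFIGURATION OF A (1.7)-REGULAR
FIELD, WITH ONLY «e SUFFICIENTLY SMALL»**: `‖G_k(□,Ã_j)(D^η_{Ã_j,μ})ᵀΦ‖_∞ ≤ C‖Φ‖_{p,η}` for every `μ` (the third
operator of «G_k(□), ∂^η_μG_k(□), G_k(□)∂^{η*}_μ are bounded operators from L^{p₁}(□) with p₁ > d to L^∞(□)», here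
at `Ã_j`; `B4Lemma22EtaBox.lemma22_17_weighted_box_dual_sup` with every operator-side and field hypothesis DISCHARGED).
[cite: Balaban1983RegularityDecay, Lemma 2.2 (2.17) p. 578 with (2.40)–(2.41) p. 583, §2 p. 575 (Ã_j), (1.7) p. 573] -/
theorem lemma22_dual_sup_cubeField (F : OrthFlow ι) {ℓ₁ : ℝ} (hℓ₁ : 0 ≤ ℓ₁)
    (hLip : ∀ t (v : ι → ℝ), ((F.U t - 1) *ᵥ v) ⬝ᵥ ((F.U t - 1) *ᵥ v) ≤ (ℓ₁ * t) ^ 2 * (v ⬝ᵥ v))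
    (d ℓ : ℕ) (hℓ : 1 ≤ ℓ) (amin aplus m2plus : ℝ) (ha : 0 < amin) {p₁ : ℝ} (hp₁ : (d : ℝ) + 1 < p₁) :
    ∃ C : ℝ, 0 < C ∧ ∀ (creg β : ℝ), 0 ≤ creg → 0 < β → ∀ (S K : ℕ), 1 ≤ K →
      ∃ e₁ : ℝ, 0 < e₁ ∧ ∀ (k : ℕ), 1 ≤ k → ∀ (hn : 1 ≤ (ℓ + 1) ^ k), 16 ≤ (ℓ + 1) ^ k * K →
      ∀ (a m2 : ℝ), amin ≤ a → a ≤ aplus → 0 ≤ m2 → m2 ≤ m2plus →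
      ∀ (M : Fin (d + 1) → ℕ), (∀ i, 1 ≤ M i) → (∀ i, M i ≤ S) →
      ∀ (j : Fin (d + 1) → ℤ), (∀ μ, 1 ≤ j μ) → (∀ μ, (K : ℤ) * (j μ + 1) ≤ M μ) →
      ∀ (Ac : (Fin (d + 1) → ℤ) → Fin (d + 1) → ℝ) (e : ℝ), 0 < e → e ≤ e₁ →
        (∀ x ∈ Box d ℓ k M, ∀ μ ν : Fin (d + 1),
          |Ac (x + e1 μ) ν - Ac x ν| ≤ creg * e ^ (β - 1) / ((ℓ + 1) ^ k : ℕ)) →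
      ∀ (p : ℝ), p₁ ≤ p →
      ∀ (Φ : ↥(Box d ℓ k M) × ι → ℝ) (μ : Fin (d + 1)),
        supN ((greenA d F (e / ((ℓ + 1) ^ k : ℕ)) ℓ k a m2 M (baseEmb hn M) (stairContour hn M)
              (cubeField (Box d ℓ k M) ((ℓ + 1) ^ k) K j (Ac 0) Ac)
            * (derivA d F (e / ((ℓ + 1) ^ k : ℕ)) ℓ k M (cubeField (Box d ℓ k M) ((ℓ + 1) ^ k) K j (Ac 0) Ac) μ)ᵀ)
            *ᵥ Φ) ≤ C * lpW d ℓ k p Φ := by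
  obtain ⟨c, hc, C', hC', hL⟩ := lemma22_17_weighted_box_dual_sup F hℓ₁ hLip 1 d ℓ hℓ amin aplus m2plus ha hp₁
  have hp₁1 : 1 < p₁ := lt_of_le_of_lt (by simp only [le_add_iff_nonneg_left]; positivity) hp₁
  set C : ℝ := (2 + ℓ₁) * (2 * C') with hC_def
  have hC0 : 0 < C := by rw [hC_def]; positivity
  refine ⟨C, hC0, fun creg β hcreg hβ S K hK1 => ?_⟩
  obtain ⟨e₁, he₁, hth⟩ := cubeField_threshold d (c := c) (aplus := aplus) hℓ₁ hc.le ha hcreg hβ S K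
  refine ⟨e₁, he₁, ?_⟩
  intro k hk hn hnK a m2 e1' e2 e3 e4 M hM hS j hjlo hjhi Ac e he hle h17 p hp Φ μ
  obtain ⟨hak1, hak2⟩ := aSeq_window hℓ hk ha e1' e2
  obtain ⟨hθ1, -, hsm⟩ := hth e he hle _ hak1 hak2
  have ha' : 0 < a := lt_of_lt_of_le ha e1'
  obtain ⟨hunit, hθ0, hA', hθ'0, hder, hbd, hτ0, hτ⟩ :=
    cubeField_pkg F hℓ hk hn ha' e3 hS hK1 hnK hjlo hjhi hcreg he h17 (β := β)
  have hp1 : 1 < p := lt_of_lt_of_le hp₁1 hp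
  obtain ⟨-, main2⟩ := hL k hk a m2 e1' e2 e3 e4 M hM (baseEmb hn M) (stairContour hn M)
    (fun y x hw => stairContour_end hn M y x hw) (fun μ => e / ((ℓ + 1) ^ k : ℕ) * Ac 0 μ) _ _ _ _
    hunit hθ0 hA' hθ'0 hder hbd hτ0 hτ hsm p p.conjExponent (Real.HolderConjugate.conjExponent hp1) hp Φ
  have hc2 : 0 ≤ 2 * C' := by positivity
  have hC2 : (1 + ℓ₁ * (((d : ℝ) + 1) * S * creg * e ^ β)) * (2 * C') ≤ C := by
    rw [hC_def]
    refine mul_le_mul_of_nonneg_right ?_ hc2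
    have : ℓ₁ * (((d : ℝ) + 1) * S * creg * e ^ β) ≤ ℓ₁ * 1 := mul_le_mul_of_nonneg_left hθ1 hℓ₁
    linarith
  rw [derivA_smul, greenA_smul, smul_cubeField]
  exact (main2 μ).trans (mul_le_mul_of_nonneg_right hC2 (lpW_nonneg d ℓ k p Φ))

end Dual

/-! ## §4. The third member at the two corners `q = p = 1` and `q = p = ∞` -/

section Corners

variable {ι : Type} [Fintype ι] [DecidableEq ι]

omit [DecidableEq ι] in
/-- `‖Φ‖_{1,η} = η^{d+1}‖Φ‖₁`: the weighted `L¹` norm of `B4Lemma22EtaBox` is `vol⁻¹` times the mixed `ℓ¹` norm `l1N`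
(`lpM_one`). [cite: Balaban1983RegularityDecay, Lemma 2.2 (2.17) p. 578 (the norms `‖·‖_p`), dictionary] -/
theorem lpW_one_eq {X : Type*} [Fintype X] [DecidableEq X] (d ℓ k : ℕ) (Φ : X × ι → ℝ) :
    lpW d ℓ k 1 Φ = (vol d ℓ k)⁻¹ * l1N Φ := by
  rw [lpW, inv_one, Real.rpow_one, lpM_one]
set_option maxHeartbeats 400000 in
/-- **LEMMA 2.2 (2.17), THIRD MEMBER, THE CORNERS `q = p = 1` AND `q = p = ∞`, AT THE CUBE CONFIGURATION OF A
(1.7)-REGULAR FIELD, WITH ONLY «e SUFFICIENTLY SMALL»**: `‖G_k(□,Ã_j)(D^η_{Ã_j,μ})ᵀΦ‖_{1,η} ≤ C‖Φ‖_{1,η}` («For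
q = p = 1 we get it by duality argument»; `B4Lemma22DualL1.lemma22_17_l1_stair` discharged) and
`‖G_k(□,Ã_j)(D^η_{Ã_j,μ})ᵀΦ‖_∞ ≤ C‖Φ‖_∞` (the `ℓ¹` bootstrap of p. 581 dualised: `B4Lemma22L1Stair.lemma22_17_l1_deriv_stair`
discharged), for every `μ`. [cite: Balaban1983RegularityDecay, Lemma 2.2 (2.17) p. 578 with pp. 581, 583, §2 p. 575 (Ã_j), (1.7) p. 573] -/
theorem lemma22_dual_corners_cubeField (F : OrthFlow ι) {ℓ₁ : ℝ} (hℓ₁ : 0 ≤ ℓ₁)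
    (hLip : ∀ t (v : ι → ℝ), ((F.U t - 1) *ᵥ v) ⬝ᵥ ((F.U t - 1) *ᵥ v) ≤ (ℓ₁ * t) ^ 2 * (v ⬝ᵥ v))
    (d ℓ : ℕ) (hℓ : 1 ≤ ℓ) (amin aplus m2plus : ℝ) (ha : 0 < amin) :
    ∃ C : ℝ, 0 < C ∧ ∀ (creg β : ℝ), 0 ≤ creg → 0 < β → ∀ (S K : ℕ), 1 ≤ K →
      ∃ e₁ : ℝ, 0 < e₁ ∧ ∀ (k : ℕ), 1 ≤ k → ∀ (hn : 1 ≤ (ℓ + 1) ^ k), 16 ≤ (ℓ + 1) ^ k * K →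
      ∀ (a m2 : ℝ), amin ≤ a → a ≤ aplus → 0 ≤ m2 → m2 ≤ m2plus →
      ∀ (M : Fin (d + 1) → ℕ), (∀ i, 1 ≤ M i) → (∀ i, M i ≤ S) →
      ∀ (j : Fin (d + 1) → ℤ), (∀ μ, 1 ≤ j μ) → (∀ μ, (K : ℤ) * (j μ + 1) ≤ M μ) →
      ∀ (Ac : (Fin (d + 1) → ℤ) → Fin (d + 1) → ℝ) (e : ℝ), 0 < e → e ≤ e₁ →
        (∀ x ∈ Box d ℓ k M, ∀ μ ν : Fin (d + 1),
          |Ac (x + e1 μ) ν - Ac x ν| ≤ creg * e ^ (β - 1) / ((ℓ + 1) ^ k : ℕ)) →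
      ∀ (Φ : ↥(Box d ℓ k M) × ι → ℝ) (μ : Fin (d + 1)),
        lpW d ℓ k 1 ((greenA d F (e / ((ℓ + 1) ^ k : ℕ)) ℓ k a m2 M (baseEmb hn M) (stairContour hn M)
              (cubeField (Box d ℓ k M) ((ℓ + 1) ^ k) K j (Ac 0) Ac)
            * (derivA d F (e / ((ℓ + 1) ^ k : ℕ)) ℓ k M (cubeField (Box d ℓ k M) ((ℓ + 1) ^ k) K j (Ac 0) Ac) μ)ᵀ)
            *ᵥ Φ) ≤ C * lpW d ℓ k 1 Φ ∧
        supN ((greenA d F (e / ((ℓ + 1) ^ k : ℕ)) ℓ k a m2 M (baseEmb hn M) (stairContour hn M)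
              (cubeField (Box d ℓ k M) ((ℓ + 1) ^ k) K j (Ac 0) Ac)
            * (derivA d F (e / ((ℓ + 1) ^ k : ℕ)) ℓ k M (cubeField (Box d ℓ k M) ((ℓ + 1) ^ k) K j (Ac 0) Ac) μ)ᵀ)
            *ᵥ Φ) ≤ C * supN Φ := by
  obtain ⟨c, hc, hL⟩ := lemma22_17_l1_stair F hℓ₁ hLip 1 d ℓ hℓ amin aplus m2plus ha
  obtain ⟨c', hc', hL'⟩ := lemma22_17_l1_deriv_stair F hℓ₁ hLip 1 d ℓ hℓ amin aplus m2plus ha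
  set C : ℝ := (2 + ℓ₁) * (2 * (((d : ℝ) + 2) * (c + c'))) with hC_def
  have hC0 : 0 < C := by rw [hC_def]; positivity
  refine ⟨C, hC0, fun creg β hcreg hβ S K hK1 => ?_⟩
  obtain ⟨e₁, he₁, hth⟩ := cubeField_threshold d (c := c) (aplus := aplus) hℓ₁ hc.le ha hcreg hβ S K
  obtain ⟨e₂, he₂, hth'⟩ := cubeField_threshold d (c := c') (aplus := aplus) hℓ₁ hc'.le ha hcreg hβ S K
  refine ⟨min e₁ e₂, lt_min he₁ he₂, ?_⟩
  intro k hk hn hnK a m2 e1' e2 e3 e4 M hM hS j hjlo hjhi Ac e he hle h17 Φ μ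
  obtain ⟨hak1, hak2⟩ := aSeq_window hℓ hk ha e1' e2
  obtain ⟨hθ1, hsm2, hsm⟩ := hth e he (hle.trans (min_le_left _ _)) _ hak1 hak2
  obtain ⟨-, -, hsm'⟩ := hth' e he (hle.trans (min_le_right _ _)) _ hak1 hak2
  have ha' : 0 < a := lt_of_lt_of_le ha e1'
  obtain ⟨-, hθ0, hA', hθ'0, hder, hbd, -, -⟩ :=
    cubeField_pkg F hℓ hk hn ha' e3 hS hK1 hnK hjlo hjhi hcreg he h17 (β := β)
  obtain ⟨-, main1⟩ := hL k hk hn a m2 e1' e2 e3 e4 M hM (fun μ => e / ((ℓ + 1) ^ k : ℕ) * Ac 0 μ) _ _ _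
    hθ0 hA' hθ'0 hder hbd hsm2 hsm Φ
  obtain ⟨-, -, -, main2⟩ := hL' k hk hn a m2 e1' e2 e3 e4 M hM (fun μ => e / ((ℓ + 1) ^ k : ℕ) * Ac 0 μ) _ _ _
    hθ0 hA' hθ'0 hder hbd hsm2 hsm' Φ
  have hθle : ℓ₁ * (((d : ℝ) + 1) * S * creg * e ^ β) ≤ ℓ₁ * 1 := mul_le_mul_of_nonneg_left hθ1 hℓ₁
  have hd2 : 0 ≤ (d : ℝ) + 2 := by positivity
  have hC1 : (1 + ℓ₁ * (((d : ℝ) + 1) * S * creg * e ^ β)) * (2 * (((d : ℝ) + 2) * c)) ≤ C := by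
    rw [hC_def]
    refine mul_le_mul (by linarith) ?_ (by positivity) (by positivity)
    nlinarith
  have hC2 : (1 + ℓ₁ * (((d : ℝ) + 1) * S * creg * e ^ β)) * (2 * (((d : ℝ) + 2) * c')) ≤ C := by
    rw [hC_def]
    refine mul_le_mul (by linarith) ?_ (by positivity) (by positivity)
    nlinarith
  have hvol : 0 < (vol d ℓ k)⁻¹ := inv_pos.2 (vol_pos d ℓ k)
  constructor
  · rw [derivA_smul, greenA_smul, smul_cubeField, lpW_one_eq, lpW_one_eq, ← mul_assoc, mul_comm C, mul_assoc]
    refine mul_le_mul_of_nonneg_left ?_ hvol.le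
    exact (main1 μ).trans (mul_le_mul_of_nonneg_right hC1 (l1N_nonneg Φ))
  · rw [derivA_smul, greenA_smul, smul_cubeField]
    exact (main2 μ).trans (mul_le_mul_of_nonneg_right hC2 (supN_nonneg Φ))

end Corners

end

end Literature.MathematicalPhysics.QuantumFieldTheory.Balaban1983to89.B4Lemma22EdgesCubeField
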